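import Literature.NumberTheory.Irrationality.LaiYu2020.NumberOfIrrationalOddZetaValues
import Literature.NumberTheory.Multiplicative.TotientValueCounting
import HarnessLib

/-!
# Lai–Yu 2020, Proposition 2.2 (1) and Proposition 6.1 — proofs

Topic `Literature/NumberTheory/Irrationality/LaiYu2020`. Companion ("Proofs") file of
`NumberOfIrrationalOddZetaValues.lean`: it DISCHARGES two of the named facts typed there from
L. Lai, P. Yu, *A note on the number of irrational odd zeta values*, Compositio Math. **156** (2020)
1699–1717 = arXiv:1911.08458 [LaiYu2020] (held: `paper:arxiv-1911.08458`; §2 p. 4 and §6 p. 11 of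
the arXiv text read on the page):

* `card_denominatorSet_holds : card_denominatorSet` — **Proposition 2.2 (1)**,
  `|Ψ_B| = (ζ(2)ζ(3)/ζ(6) + o(1)) B` ("For the first proposition, we refer the readers to [Dr70] or
  [Ba72]"): this is Dressler 1970 / Bateman 1972 (main term), PROVED in the tree as
  `Literature.NumberTheory.Multiplicative.TotientValueCounting.tendsto_count_div` (Wiener–Ikehara
  route of Montgomery–Vaughan §8.3.1 Exercise 2) with the closed form of the constant
  `TotientValueCounting.ofReal_density`; here only the bridge `Ψ_B = {k ≥ 1 : φ(k) ≤ B}`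
  (definitional) and `zetaValue k = ζ(k)` (`ofReal_zetaValue`).
* `prop61_holds : prop61` — **Proposition 6.1**: for `D` pairwise distinct positive integers
  `b₁, …, b_D`, `∏ bᵢ^{φ(bᵢ)} ≥ exp((½ ζ(6)/(ζ(2)ζ(3)) + o(1)) D² log D)`. Printed proof (p. 11):
  "`log ∏ bᵢ^{φ(bᵢ)} ≥ ∑ φ(bᵢ) log φ(bᵢ) ≥ ∑ φ(b'ᵢ) log φ(b'ᵢ)` where `b'₁, …, b'_D` are the `D`
  smallest positive integers in the linear order `≺` [by `φ`, then by size] … there exists an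
  integer `B` such that `Ψ_{B−1} ⊂ {b'₁, ⋯, b'_D} ⊂ Ψ_B`. Following the same lines in the proof of
  Lemma 2.4 [summation by parts against `|Ψ_x| = (ζ(2)ζ(3)/ζ(6) + o(1)) x`], we complete this
  proposition." Formalisation: the `D` smallest elements are replaced by the equivalent EXCHANGE
  inequality `∑_{k ∈ Ψ_M} φ(k) log φ(k) ≤ ∑ᵢ φ(bᵢ) log φ(bᵢ)` whenever `|Ψ_M| ≤ D`
  (`weightedSum_le_sum`, with `M` = the largest integer with `|Ψ_M| ≤ D`), and the summation by
  parts by the layer-cake bound `∑_{k ∈ Ψ_M ∖ Ψ_a} φ(k) ≥ ∑_{a < j ≤ M} (|Ψ_M| − |Ψ_{j−1}|)`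
  (`sum_Ioc_count_sub_le`) evaluated with `|Ψ_x| = (A + o(1)) x`, `A = ζ(2)ζ(3)/ζ(6)`; the
  constant `½ ζ(6)/(ζ(2)ζ(3)) = 1/(2A)` arises as `(A/2) · (1/A)²`.

Theorems only (no definitions, no named facts; sorry-free): `Ψ_M` is written
`(finite_count_set M).toFinset`, `S(M) = ∑_{k ∈ Ψ_M} φ(k) log φ(k)` is written out, and
`M(D) = Nat.find (exists_count_gt D)`.

## References

* [LaiYu2020] L. Lai, P. Yu, Compositio Math. 156 (2020) 1699–1717, Prop. 2.2 (1) (§2), Prop. 6.1 (§6).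
* [MontgomeryVaughan2007] H. L. Montgomery, R. C. Vaughan, *Multiplicative Number Theory I*, CUP
  2007, §8.3.1 Exercise 2 (Dressler 1970; Bateman 1972).
-/

noncomputable section

open Filter Topology Finset
open Literature.NumberTheory.Multiplicative.TotientValueCounting

namespace Literature.NumberTheory.Irrationality.LaiYu2020

open Literature.NumberTheory.Transcendental (zetaValue ofReal_zetaValue)

/-! ### Proposition 2.2 (1) -/

/-- `A = ζ(2)ζ(3)/ζ(6)` as real numbers (`zetaValue k = ∑ 1/n^k`).
[cite: LaiYu2020, Prop. 2.2 (1)] -/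
theorem density_eq_zetaValue :
    density = zetaValue 2 * zetaValue 3 / zetaValue 6 := by
  apply Complex.ofReal_injective
  rw [ofReal_density]
  push_cast
  rw [ofReal_zetaValue (by norm_num), ofReal_zetaValue (by norm_num), ofReal_zetaValue (by norm_num)]
  norm_num

/-- `|Ψ_B| = Φ(B)` (the same set). [cite: LaiYu2020, Def. 2.1 (1)] -/
theorem ncard_denominatorSet (B : ℝ) : (denominatorSet B).ncard = count B := rfl

/-- **Discharge of `card_denominatorSet`** (Lai–Yu 2020, Prop. 2.2 (1); Dressler 1970, Bateman
1972): `|Ψ_B|/B → ζ(2)ζ(3)/ζ(6)`. [cite: LaiYu2020, Prop. 2.2 (1)]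
[cite: MontgomeryVaughan2007, §8.3.1 Exercise 2 (g)] -/
theorem card_denominatorSet_holds : card_denominatorSet := by
  unfold card_denominatorSet
  rw [← density_eq_zetaValue]
  exact tendsto_count_div

/-! ### Proposition 6.1: auxiliary objects -/


/-- [folklore] -/
private theorem mem_levelSet {M k : ℕ} : k ∈ (finite_count_set ((M : ℕ) : ℝ)).toFinset ↔ 0 < k ∧ Nat.totient k ≤ M := by
  rw [Set.Finite.mem_toFinset, Set.mem_setOf_eq, Nat.cast_le]

/-- [folklore] -/
private theorem card_levelSet (M : ℕ) :
    ((finite_count_set ((M : ℕ) : ℝ)).toFinset).card = count M := by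
  rw [count, Set.ncard_eq_toFinset_card _ (finite_count_set (M : ℝ))]

/-- [folklore] -/
private theorem levelSet_mono {a M : ℕ} (h : a ≤ M) : (finite_count_set ((a : ℕ) : ℝ)).toFinset ⊆ (finite_count_set ((M : ℕ) : ℝ)).toFinset := fun k hk => by
  rw [mem_levelSet] at hk ⊢
  exact ⟨hk.1, hk.2.trans h⟩

/-- [folklore] -/
private theorem count_zero : count (0 : ℕ) = 0 := by
  rw [← card_levelSet, Finset.card_eq_zero, Finset.eq_empty_iff_forall_notMem]
  intro k hk
  rw [mem_levelSet] at hk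
  have := Nat.totient_pos.2 hk.1
  omega


/-- [folklore] -/
private theorem g_nonneg (m : ℕ) : 0 ≤ (m : ℝ) * Real.log m := by
  rcases Nat.eq_zero_or_pos m with rfl | hm
  · simp
  · exact mul_nonneg (Nat.cast_nonneg _) (Real.log_nonneg (by exact_mod_cast hm))

/-- [folklore] -/
private theorem g_mono {m n : ℕ} (h : m ≤ n) : (m : ℝ) * Real.log m ≤ (n : ℝ) * Real.log n := by
  rcases Nat.eq_zero_or_pos m with rfl | hm
  · simpa using g_nonneg n
  · have hm' : (1 : ℝ) ≤ m := by exact_mod_cast hm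
    have hmn : (m : ℝ) ≤ n := by exact_mod_cast h
    exact mul_le_mul hmn (Real.log_le_log (by linarith) hmn) (Real.log_nonneg hm') (by linarith)

/-! ### The exchange inequality (the `D` `≺`-smallest integers) -/

/-- **Exchange inequality**: if `|Ψ_M| ≤ |S|` for a finite set `S` of positive integers, then
`∑_{k ∈ Ψ_M} φ(k) log φ(k) ≤ ∑_{k ∈ S} φ(k) log φ(k)` (the printed "the `D` smallest positive
integers in the linear order `≺`" step: every `k ∈ S ∖ Ψ_M` has `φ(k) > M ≥ φ(k')` for all
`k' ∈ Ψ_M ∖ S`, and `|S ∖ Ψ_M| ≥ |Ψ_M ∖ S|`). [cite: LaiYu2020, proof of Prop. 6.1] -/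
theorem weightedSum_le_sum {S : Finset ℕ} (hS : ∀ k ∈ S, 0 < k) {M : ℕ}
    (hM : count M ≤ S.card) :
    (∑ k ∈ (finite_count_set ((M : ℕ) : ℝ)).toFinset, (Nat.totient k : ℝ) * Real.log (Nat.totient k)) ≤ ∑ k ∈ S, (Nat.totient k : ℝ) * Real.log (Nat.totient k) := by
  classical
  set T := (finite_count_set ((M : ℕ) : ℝ)).toFinset with hT
  set g : ℕ → ℝ := fun k => (Nat.totient k : ℝ) * Real.log (Nat.totient k) with hg
  have hsplitS := Finset.sum_inter_add_sum_sdiff S T g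
  have hsplitT := Finset.sum_inter_add_sum_sdiff T S g
  have hinter : ∑ k ∈ S ∩ T, g k = ∑ k ∈ T ∩ S, g k := by rw [inter_comm]
  have hcard : (T \ S).card ≤ (S \ T).card := by
    have h1 := Finset.card_sdiff_add_card_inter T S
    have h2 := Finset.card_sdiff_add_card_inter S T
    have h3 : (T ∩ S).card = (S ∩ T).card := by rw [inter_comm]
    have h4 : T.card ≤ S.card := by rw [hT, card_levelSet]; exact hM
    omega
  have hTS : ∀ k ∈ T \ S, g k ≤ (M : ℝ) * Real.log M := by
    intro k hk
    rw [Finset.mem_sdiff, hT, mem_levelSet] at hk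
    exact g_mono hk.1.2
  have hST : ∀ k ∈ S \ T, (M : ℝ) * Real.log M ≤ g k := by
    intro k hk
    rw [Finset.mem_sdiff, hT, mem_levelSet] at hk
    have hk' : M ≤ Nat.totient k := by
      by_contra h
      exact hk.2 ⟨hS k hk.1, by omega⟩
    exact g_mono hk'
  have key : ∑ k ∈ T \ S, g k ≤ ∑ k ∈ S \ T, g k :=
    calc ∑ k ∈ T \ S, g k ≤ (T \ S).card • ((M : ℝ) * Real.log M) := sum_le_card_nsmul _ _ _ hTS
      _ ≤ (S \ T).card • ((M : ℝ) * Real.log M) := by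
          rw [nsmul_eq_mul, nsmul_eq_mul]
          exact mul_le_mul_of_nonneg_right (by exact_mod_cast hcard) (g_nonneg M)
      _ ≤ ∑ k ∈ S \ T, g k := card_nsmul_le_sum _ _ _ hST
  have hW : (∑ k ∈ (finite_count_set ((M : ℕ) : ℝ)).toFinset, (Nat.totient k : ℝ) * Real.log (Nat.totient k)) = ∑ k ∈ T, g k := rfl
  rw [hW]
  linarith

/-! ### The layer-cake bound and the asymptotic lower bound for `S(M)` -/

/-- Layer-cake bound: `∑_{a < j ≤ M} (|Ψ_M| − |Ψ_{j−1}|) ≤ ∑_{k ∈ Ψ_M ∖ Ψ_a} φ(k)` (each `k` with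
`a < φ(k) ≤ M` is counted once for every `j ∈ (a, φ(k)]`).
[cite: LaiYu2020, proof of Prop. 6.1 (summation by parts)] -/
theorem sum_Ioc_count_sub_le (a M : ℕ) :
    ∑ j ∈ Ioc a M, ((count M : ℝ) - count (j - 1 : ℕ)) ≤
      ∑ k ∈ (finite_count_set ((M : ℕ) : ℝ)).toFinset \ (finite_count_set ((a : ℕ) : ℝ)).toFinset, (Nat.totient k : ℝ) := by
  classical
  have hdiff : ∀ j ∈ Ioc a M, ((count M : ℝ) - count (j - 1 : ℕ)) =
      ∑ k ∈ (finite_count_set ((M : ℕ) : ℝ)).toFinset \ (finite_count_set ((a : ℕ) : ℝ)).toFinset, (if j ≤ Nat.totient k then (1 : ℝ) else 0) := by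
    intro j hj
    rw [mem_Ioc] at hj
    have hsub : (finite_count_set ((j - 1 : ℕ) : ℝ)).toFinset ⊆ (finite_count_set ((M : ℕ) : ℝ)).toFinset := levelSet_mono (by omega)
    have hc : ((count M : ℝ) - count (j - 1 : ℕ)) =
        (((finite_count_set ((M : ℕ) : ℝ)).toFinset \ (finite_count_set ((j - 1 : ℕ) : ℝ)).toFinset).card : ℝ) := by
      rw [card_sdiff_of_subset hsub, Nat.cast_sub (card_le_card hsub), card_levelSet,
        card_levelSet]
    rw [hc, Finset.sum_boole]
    congr 2
    ext k
    simp only [Finset.mem_sdiff, mem_levelSet, mem_filter, not_and, not_le]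
    constructor
    · rintro ⟨⟨hk0, hkM⟩, hnot⟩
      have h1 : j - 1 < Nat.totient k := hnot hk0
      exact ⟨⟨⟨hk0, hkM⟩, fun _ => by omega⟩, by omega⟩
    · rintro ⟨⟨⟨hk0, hkM⟩, -⟩, hj'⟩
      exact ⟨⟨hk0, hkM⟩, fun _ => by omega⟩
  rw [sum_congr rfl hdiff, sum_comm]
  refine sum_le_sum fun k _ => ?_
  rw [Finset.sum_boole]
  have : ((Ioc a M).filter (fun j => j ≤ Nat.totient k)).card ≤ Nat.totient k := by
    calc ((Ioc a M).filter (fun j => j ≤ Nat.totient k)).card ≤ (Ioc 0 (Nat.totient k)).card := by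
          refine card_le_card fun j hj => ?_
          simp only [mem_filter, mem_Ioc] at hj ⊢
          omega
      _ = Nat.totient k := by simp
  exact_mod_cast this

/-- Two-sided linear bounds on `Φ` from `Φ(x)/x → A`: for every `η > 0` there are `X₀ ≥ 1` and
`C₀ ≥ 0` with `(A − η) x ≤ Φ(x)` for `x ≥ X₀` and `Φ(n) ≤ (A + η) n + C₀` for every `n`.
[cite: LaiYu2020, Prop. 2.2 (1)] -/
theorem count_linear_bounds {η : ℝ} (hη : 0 < η) :
    ∃ X₀ C₀ : ℝ, 1 ≤ X₀ ∧ 0 ≤ C₀ ∧ (∀ x : ℝ, X₀ ≤ x → (density - η) * x ≤ count x) ∧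
      (∀ n : ℕ, (count n : ℝ) ≤ (density + η) * n + C₀) := by
  have hev := tendsto_count_div.eventually (Ioo_mem_nhds (by linarith : density - η < density)
    (by linarith : density < density + η))
  obtain ⟨X, hX⟩ := eventually_atTop.1 hev
  refine ⟨max X 1, count (max X 1), le_max_right _ _, Nat.cast_nonneg _, fun x hx => ?_,
    fun n => ?_⟩
  · have hx0 : 0 < x := lt_of_lt_of_le one_pos ((le_max_right _ _).trans hx)
    have h := (hX x ((le_max_left _ _).trans hx)).1
    rw [lt_div_iff₀ hx0] at h
    exact h.le
  · by_cases hn : max X 1 ≤ n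
    · have hn0 : (0 : ℝ) < n := lt_of_lt_of_le one_pos ((le_max_right _ _).trans hn)
      have h := (hX n ((le_max_left _ _).trans hn)).2
      rw [div_lt_iff₀ hn0] at h
      have : (0 : ℝ) ≤ count (max X 1) := Nat.cast_nonneg _
      linarith
    · have h1 : (count n : ℝ) ≤ count (max X 1) := by
        exact_mod_cast count_mono (not_le.1 hn).le
      have h2 : 0 ≤ (density + η) * n :=
        mul_nonneg (by linarith [density_pos]) (Nat.cast_nonneg _)
      linarith

/-- [folklore] -/
private theorem sum_Ioc_zero_sub_one (M : ℕ) :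
    ∑ j ∈ Ioc 0 M, ((j : ℝ) - 1) = ((M : ℝ) ^ 2 - M) / 2 := by
  induction M with
  | zero => simp
  | succ n ih =>
    rw [sum_Ioc_succ_top (Nat.zero_le n), ih]
    push_cast
    ring

/-- [folklore] -/
private theorem sum_Ioc_sub_one_le (a M : ℕ) : ∑ j ∈ Ioc a M, ((j : ℝ) - 1) ≤ (M : ℝ) ^ 2 / 2 := by
  have h1 : ∑ j ∈ Ioc a M, ((j : ℝ) - 1) ≤ ∑ j ∈ Ioc 0 M, ((j : ℝ) - 1) := by
    refine sum_le_sum_of_subset_of_nonneg (fun j hj => ?_) fun j hj _ => ?_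
    · rw [mem_Ioc] at hj ⊢; omega
    · rw [mem_Ioc] at hj
      have : (1 : ℝ) ≤ j := by exact_mod_cast hj.1
      linarith
  rw [sum_Ioc_zero_sub_one] at h1
  have : (0 : ℝ) ≤ M := Nat.cast_nonneg _
  linarith

/-- **Asymptotic lower bound** `S(M) = ∑_{k ∈ Ψ_M} φ(k) log φ(k) ≥ (A/2 − δ) M² log M` for large
`M` (the summation-by-parts step "following the same lines in the proof of Lemma 2.4":
`∑_{b ∈ Ψ_B} φ(b) log φ(b) = ∫ x log x d|Ψ_x| = (½ A + o(1)) B² log B`; only the lower bound is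
needed, proved here through the cut `a = ⌊θM⌋`, the layer-cake bound and the linear bounds on
`|Ψ_x|`). [cite: LaiYu2020, proof of Prop. 6.1 and of Lemma 2.4] -/
theorem weightedSum_lower {δ : ℝ} (hδ : 0 < δ) :
    ∃ M₀ : ℕ, ∀ M : ℕ, M₀ ≤ M → (density / 2 - δ) * (M : ℝ) ^ 2 * Real.log M ≤ (∑ k ∈ (finite_count_set ((M : ℕ) : ℝ)).toFinset, (Nat.totient k : ℝ) * Real.log (Nat.totient k)) := by
  classical
  have hA := density_pos
  have hWnn : ∀ M, 0 ≤ (∑ k ∈ (finite_count_set ((M : ℕ) : ℝ)).toFinset, (Nat.totient k : ℝ) * Real.log (Nat.totient k)) := fun M => sum_nonneg fun k _ => g_nonneg _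
  -- trivial when the coefficient is non-positive
  by_cases hδA : density / 2 ≤ δ
  · refine ⟨1, fun M hM => le_trans ?_ (hWnn M)⟩
    have hM1 : (1 : ℝ) ≤ M := by exact_mod_cast hM
    have : (density / 2 - δ) * (M : ℝ) ^ 2 * Real.log M ≤ 0 :=
      mul_nonpos_of_nonpos_of_nonneg (mul_nonpos_of_nonpos_of_nonneg (by linarith) (by positivity))
        (Real.log_nonneg hM1)
    exact this
  push Not at hδA
  -- parameters
  set θ : ℝ := min (1 / 2) (δ / (4 * density)) with hθ
  have hθpos : 0 < θ := lt_min (by norm_num) (by positivity)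
  have hθhalf : θ ≤ 1 / 2 := min_le_left _ _
  have hθA : θ * density ≤ δ / 4 := by
    have : θ ≤ δ / (4 * density) := min_le_right _ _
    calc θ * density ≤ δ / (4 * density) * density := by gcongr
      _ = δ / 4 := by field_simp
  set η : ℝ := δ / 8 with hη
  have hηpos : 0 < η := by positivity
  have hη2 : 0 < density - 2 * η := by rw [hη]; linarith
  obtain ⟨X₀, C₀, hX₀, hC₀, hlow, hup⟩ := count_linear_bounds hηpos
  -- choice of `M₀`
  obtain ⟨M₁, hM₁⟩ : ∃ M₁ : ℕ, ∀ M : ℕ, M₁ ≤ M →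
      (X₀ ≤ (M : ℝ) ∧ C₀ ≤ η * M ∧ 1 ≤ θ * M ∧
        -Real.log θ * density ≤ (δ / 4) * Real.log M) := by
    have h1 : ∀ᶠ M : ℕ in atTop, X₀ ≤ (M : ℝ) :=
      tendsto_natCast_atTop_atTop.eventually_ge_atTop X₀
    have h2 : ∀ᶠ M : ℕ in atTop, C₀ ≤ η * M :=
      ((tendsto_natCast_atTop_atTop (R := ℝ)).const_mul_atTop hηpos).eventually_ge_atTop C₀
    have h3 : ∀ᶠ M : ℕ in atTop, 1 ≤ θ * M :=
      ((tendsto_natCast_atTop_atTop (R := ℝ)).const_mul_atTop hθpos).eventually_ge_atTop 1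
    have h4 : ∀ᶠ M : ℕ in atTop, -Real.log θ * density ≤ (δ / 4) * Real.log M :=
      (((Real.tendsto_log_atTop.comp (tendsto_natCast_atTop_atTop (R := ℝ))).const_mul_atTop
        (by positivity : (0 : ℝ) < δ / 4))).eventually_ge_atTop _
    obtain ⟨M₁, h⟩ := eventually_atTop.1 (h1.and (h2.and (h3.and h4)))
    exact ⟨M₁, fun M hM => by simpa only [Function.comp_apply] using h M hM⟩
  refine ⟨M₁, fun M hM => ?_⟩
  obtain ⟨hMX, hMC, hMθ, hMlog⟩ := hM₁ M hM
  have hθM : 0 < θ * M := lt_of_lt_of_le one_pos hMθ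
  have hM0 : (0 : ℝ) < M := pos_of_mul_pos_right hθM hθpos.le  -- θ * M > 0, θ > 0 ⇒ M > 0
  have hlogθM : 0 ≤ Real.log (θ * M) := Real.log_nonneg hMθ
  -- the cut `a = ⌊θ M⌋`
  set a : ℕ := ⌊θ * M⌋₊ with ha
  have haθ : (a : ℝ) ≤ θ * M := Nat.floor_le hθM.le
  have haM : a ≤ M := by
    have : (a : ℝ) ≤ M := haθ.trans (mul_le_of_le_one_left hM0.le (by linarith))
    exact_mod_cast this
  have ha1 : θ * M < (a : ℝ) + 1 := Nat.lt_floor_add_one _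
  -- Step 1: `S(M) ≥ log(a+1) · ∑_{Ψ_M ∖ Ψ_a} φ(k)`
  have hstep1 : Real.log ((a : ℝ) + 1) * ∑ k ∈ (finite_count_set ((M : ℕ) : ℝ)).toFinset \ (finite_count_set ((a : ℕ) : ℝ)).toFinset, (Nat.totient k : ℝ) ≤
      (∑ k ∈ (finite_count_set ((M : ℕ) : ℝ)).toFinset, (Nat.totient k : ℝ) * Real.log (Nat.totient k)) := by
    rw [mul_sum]
    have hsub : (finite_count_set ((M : ℕ) : ℝ)).toFinset \ (finite_count_set ((a : ℕ) : ℝ)).toFinset ⊆ (finite_count_set ((M : ℕ) : ℝ)).toFinset := sdiff_subset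
    refine (sum_le_sum fun k hk => ?_).trans
      (sum_le_sum_of_subset_of_nonneg hsub fun k _ _ => g_nonneg (Nat.totient k))
    rw [Finset.mem_sdiff, mem_levelSet, mem_levelSet, not_and, not_le] at hk
    have hφ : a + 1 ≤ Nat.totient k := hk.2 hk.1.1
    have hφ' : (a : ℝ) + 1 ≤ Nat.totient k := by exact_mod_cast hφ
    rw [mul_comm]
    exact mul_le_mul_of_nonneg_left (Real.log_le_log (by positivity) hφ') (Nat.cast_nonneg _)
  -- Step 2: the layer-cake sum is `≥ coef · M²`
  set coef : ℝ := (1 - θ) * (density - 2 * η) - (density + η) / 2 with hcoef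
  have hcoef_exp : coef = density / 2 - 5 * η / 2 - θ * density + 2 * (θ * η) := by
    rw [hcoef]; ring
  have hθη : 0 ≤ θ * η := mul_nonneg hθpos.le hηpos.le
  have hθη' : θ * η ≤ η := mul_le_of_le_one_left hηpos.le (by linarith)
  have hcoef_ge : density / 2 - 9 * δ / 16 ≤ coef := by
    rw [hcoef_exp, hη] at *
    linarith
  have hcoef_pos : 0 < coef := by linarith
  have hstep2 : coef * (M : ℝ) ^ 2 ≤ ∑ j ∈ Ioc a M, ((count M : ℝ) - count (j - 1 : ℕ)) := by
    have hterm : ∀ j ∈ Ioc a M, (density - 2 * η) * M - (density + η) * ((j : ℝ) - 1) ≤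
        (count M : ℝ) - count (j - 1 : ℕ) := by
      intro j hj
      rw [mem_Ioc] at hj
      have h1 := hlow M hMX
      have h2 := hup (j - 1)
      have h3 : (density + η) * ((j - 1 : ℕ) : ℝ) + C₀ = (density + η) * ((j : ℝ) - 1) + C₀ := by
        rw [Nat.cast_sub (by omega : 1 ≤ j), Nat.cast_one]
      have h4 := h2.trans h3.le
      linarith
    refine le_trans ?_ (sum_le_sum hterm)
    rw [sum_sub_distrib, sum_const, Nat.card_Ioc, nsmul_eq_mul, ← mul_sum]
    have hsumj := sum_Ioc_sub_one_le a M
    have hMa : (1 - θ) * M ≤ ((M - a : ℕ) : ℝ) := by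
      rw [Nat.cast_sub haM]
      linarith
    have hAη : 0 ≤ density + η := by linarith
    calc coef * (M : ℝ) ^ 2
        = (1 - θ) * M * ((density - 2 * η) * M) - (density + η) * ((M : ℝ) ^ 2 / 2) := by
          rw [hcoef]; ring
      _ ≤ ((M - a : ℕ) : ℝ) * ((density - 2 * η) * M) -
            (density + η) * ∑ j ∈ Ioc a M, ((j : ℝ) - 1) := by
          gcongr
  -- Step 3: combine
  have hlayer := sum_Ioc_count_sub_le a M
  have hX : coef * (M : ℝ) ^ 2 ≤ ∑ k ∈ (finite_count_set ((M : ℕ) : ℝ)).toFinset \ (finite_count_set ((a : ℕ) : ℝ)).toFinset, (Nat.totient k : ℝ) :=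
    hstep2.trans hlayer
  have hloga : Real.log (θ * M) ≤ Real.log ((a : ℝ) + 1) := Real.log_le_log hθM ha1.le
  have h4 : Real.log (θ * M) * (coef * (M : ℝ) ^ 2) ≤ (∑ k ∈ (finite_count_set ((M : ℕ) : ℝ)).toFinset, (Nat.totient k : ℝ) * Real.log (Nat.totient k)) := by
    refine le_trans ?_ hstep1
    exact mul_le_mul hloga hX (by positivity) (hlogθM.trans hloga)
  refine le_trans ?_ h4
  rw [Real.log_mul hθpos.ne' hM0.ne']
  -- `(A/2 − δ) log M ≤ (log θ + log M) · coef`, using `−log θ · A ≤ (δ/4) log M` and `coef ≤ A`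
  have hlogM : 0 ≤ Real.log M := by
    have : (1 : ℝ) ≤ M := by
      have h1M : 1 ≤ M := Nat.one_le_iff_ne_zero.2 (by rintro rfl; simp at hM0)
      exact_mod_cast h1M
    exact Real.log_nonneg this
  have hlogθ : Real.log θ ≤ 0 := Real.log_nonpos hθpos.le (by linarith)
  have hcoefA : coef ≤ density := by
    have hθd : 0 ≤ θ * density := by positivity
    rw [hcoef_exp]
    linarith [hθη', hηpos, hA]
  have hM2 : (0 : ℝ) ≤ (M : ℝ) ^ 2 := by positivity
  -- `log θ * coef ≥ log θ * density ≥ -(δ/4) log M`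
  have h5 : -(δ / 4) * Real.log M ≤ Real.log θ * coef := by
    have := mul_le_mul_of_nonpos_left hcoefA hlogθ
    linarith
  have h6 : (density / 2 - δ) * Real.log M ≤ (Real.log θ + Real.log M) * coef := by
    rw [add_mul]
    have h6a : Real.log M * (density / 2 - 9 * δ / 16) ≤ Real.log M * coef :=
      mul_le_mul_of_nonneg_left hcoef_ge hlogM
    have h6b : 0 ≤ δ * Real.log M := mul_nonneg hδ.le hlogM
    nlinarith [h6a, h6b, h5]
  calc (density / 2 - δ) * (M : ℝ) ^ 2 * Real.log M
      = ((density / 2 - δ) * Real.log M) * (M : ℝ) ^ 2 := by ring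
    _ ≤ ((Real.log θ + Real.log M) * coef) * (M : ℝ) ^ 2 :=
        mul_le_mul_of_nonneg_right h6 hM2
    _ = (Real.log θ + Real.log M) * (coef * (M : ℝ) ^ 2) := by ring

/-! ### The threshold `M(D)` and the conclusion -/

/-- `Φ` is unbounded along the integers. [folklore] -/
private theorem exists_count_gt (D : ℕ) : ∃ M : ℕ, D < count (M + 1 : ℕ) := by
  have h := (tendsto_count_atTop.comp tendsto_natCast_atTop_atTop).eventually_gt_atTop ((D : ℝ))
  obtain ⟨M, hM⟩ := eventually_atTop.1 h
  refine ⟨M, ?_⟩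
  have := hM (M + 1) (Nat.le_succ M)
  simp only [Function.comp_apply] at this
  exact_mod_cast this

/-- The threshold `M(D)`: the largest `M` with `|Ψ_M| ≤ D` ("there exists an integer `B` such that
`Ψ_{B−1} ⊂ {b'₁, …, b'_D} ⊂ Ψ_B`"; `M(D) = B − 1`). [cite: LaiYu2020, proof of Prop. 6.1] -/
theorem exists_threshold (D : ℕ) :
    ∃ M : ℕ, count (M : ℕ) ≤ D ∧ D < count (M + 1 : ℕ) ∧ ∀ X : ℕ, count (X : ℕ) ≤ D → X ≤ M := by
  obtain ⟨M, hM, hmin⟩ : ∃ M : ℕ, D < count (M + 1 : ℕ) ∧ ∀ m < M, ¬ D < count (m + 1 : ℕ) :=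
    ⟨Nat.find (exists_count_gt D), Nat.find_spec (exists_count_gt D),
      fun m hm => Nat.find_min (exists_count_gt D) hm⟩
  refine ⟨M, ?_, hM, fun X hX => ?_⟩
  · rcases Nat.eq_zero_or_pos M with h | h
    · subst h
      have := count_zero
      rw [Nat.cast_zero] at this ⊢
      rw [this]
      exact Nat.zero_le _
    · have := hmin (M - 1) (Nat.sub_lt h one_pos)
      rw [not_lt] at this
      have hM1 : M - 1 + 1 = M := Nat.sub_add_cancel h
      rw [hM1] at this
      exact this
  · by_contra hXM
    push Not at hXM
    have h1 : count (M + 1 : ℕ) ≤ count (X : ℕ) :=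
      count_mono (by exact_mod_cast Nat.succ_le_of_lt hXM)
    omega

/-- `M ≥ (1/A − δ) D` for large `D` whenever `D < |Ψ_{M+1}|` (from
`D < |Ψ_{M+1}| ≤ (A + η)(M + 1) + C₀`); in particular for the threshold `M(D)`.
[cite: LaiYu2020, proof of Prop. 6.1] -/
theorem threshold_lower {δ : ℝ} (hδ : 0 < δ) :
    ∃ D₀ : ℕ, ∀ D : ℕ, D₀ ≤ D → ∀ M : ℕ, D < count (M + 1 : ℕ) → (1 / density - δ) * D ≤ M := by
  have hA := density_pos
  by_cases hδA : 1 / density ≤ δ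
  · exact ⟨0, fun D _ M _ => le_trans (mul_nonpos_of_nonpos_of_nonneg (by linarith)
      (Nat.cast_nonneg _)) (Nat.cast_nonneg _)⟩
  push Not at hδA
  -- choose `η = δ A²/2`, so that `1/A − 1/(A+η) = η/(A(A+η)) ≤ η/A² = δ/2`
  set η : ℝ := δ * density ^ 2 / 2 with hη_def
  have hη : 0 < η := by positivity
  have hAη : 0 < density + η := by linarith
  have hηA : 1 / density - δ / 2 ≤ 1 / (density + η) := by
    rw [le_div_iff₀ hAη]
    have : (1 / density - δ / 2) * (density + η) = 1 - δ ^ 2 * density ^ 2 / 4 := by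
      rw [hη_def]
      field_simp
      ring
    rw [this]
    have : 0 ≤ δ ^ 2 * density ^ 2 / 4 := by positivity
    linarith
  obtain ⟨X₀, C₀, hX₀, hC₀, -, hup⟩ := count_linear_bounds hη
  obtain ⟨D₀, hD₀⟩ : ∃ D₀ : ℕ, ∀ D : ℕ, D₀ ≤ D → C₀ / (density + η) + 1 ≤ (δ / 2) * D := by
    obtain ⟨D₀, h⟩ := eventually_atTop.1
      (((tendsto_natCast_atTop_atTop (R := ℝ)).const_mul_atTop (by positivity : (0:ℝ) < δ / 2))
        |>.eventually_ge_atTop (C₀ / (density + η) + 1))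
    exact ⟨D₀, h⟩
  refine ⟨D₀, fun D hD M hM => ?_⟩
  have h1 : (D : ℝ) < (density + η) * ((M : ℝ) + 1) + C₀ := by
    have h' : ((D : ℕ) : ℝ) < (count (M + 1 : ℕ) : ℝ) := by exact_mod_cast hM
    have h'' : (count (M + 1 : ℕ) : ℝ) ≤ (density + η) * ((M + 1 : ℕ) : ℝ) + C₀ := hup (M + 1)
    have h3 : (density + η) * ((M + 1 : ℕ) : ℝ) + C₀ = (density + η) * ((M : ℝ) + 1) + C₀ := by
      push_cast; ring
    exact h'.trans_le (h''.trans h3.le)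
  -- `M ≥ D/(A+η) − C₀/(A+η) − 1`
  have h2 : (D : ℝ) / (density + η) - C₀ / (density + η) - 1 ≤ M := by
    rw [div_sub_div_same, sub_le_iff_le_add, div_le_iff₀ hAη]
    have : ((M : ℝ) + 1) * (density + η) = (density + η) * ((M : ℝ) + 1) := mul_comm _ _
    linarith
  have h3 := hD₀ D hD
  have h4 : (1 / density - δ) * D ≤ (D : ℝ) / (density + η) - C₀ / (density + η) - 1 := by
    have hD0 : (0 : ℝ) ≤ D := Nat.cast_nonneg _
    have : (1 / density - δ / 2) * D ≤ (D : ℝ) / (density + η) :=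
      calc (1 / density - δ / 2) * D = D * (1 / density - δ / 2) := mul_comm _ _
        _ ≤ D * (1 / (density + η)) := mul_le_mul_of_nonneg_left hηA hD0
        _ = (D : ℝ) / (density + η) := (div_eq_mul_one_div _ _).symm
    linarith
  exact h4.trans h2

/-- `x ↦ x² log x` is monotone on `[1, ∞)`. [folklore] -/
private theorem sq_mul_log_mono {x y : ℝ} (hx : 1 ≤ x) (hxy : x ≤ y) :
    x ^ 2 * Real.log x ≤ y ^ 2 * Real.log y := by
  have hlx : 0 ≤ Real.log x := Real.log_nonneg hx
  exact mul_le_mul (pow_le_pow_left₀ (by linarith) hxy 2) (Real.log_le_log (by linarith) hxy) hlx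
    (by positivity)

/-- **Discharge of `prop61`** (Lai–Yu 2020, Proposition 6.1): for every `ε > 0` and all large `D`,
every `D` pairwise distinct positive integers `b₁, …, b_D` satisfy
`exp((½ ζ(6)/(ζ(2)ζ(3)) − ε) D² log D) ≤ ∏ bᵢ^{φ(bᵢ)}`. Proof as printed:
`log ∏ bᵢ^{φ(bᵢ)} = ∑ φ(bᵢ) log bᵢ ≥ ∑ φ(bᵢ) log φ(bᵢ) ≥ ∑_{k ∈ Ψ_{M(D)}} φ(k) log φ(k)`
(exchange inequality) `≥ (A/2 − δ₁) M(D)² log M(D)` (summation by parts with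
`|Ψ_x| = (A + o(1)) x`) with `M(D) ≥ (1/A − δ₂) D`, and `(A/2)(1/A)² = 1/(2A) = ½ ζ(6)/(ζ(2)ζ(3))`.
[cite: LaiYu2020, Prop. 6.1 (§6)] -/
theorem prop61_holds : prop61 := by
  classical
  intro ε hε
  have hA := density_pos
  -- the constant `c = ½ ζ(6)/(ζ(2)ζ(3)) = 1/(2A)`
  have hζ2 : zetaValue 2 ≠ 0 := by
    intro h; have := density_eq_zetaValue; rw [h] at this; simp at this; linarith
  have hζ3 : zetaValue 3 ≠ 0 := by
    intro h; have := density_eq_zetaValue; rw [h] at this; simp at this; linarith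
  have hζ6 : zetaValue 6 ≠ 0 := by
    intro h; have := density_eq_zetaValue; rw [h] at this; simp at this; linarith
  have hcA : 1 / 2 * (zetaValue 6 / (zetaValue 2 * zetaValue 3)) = 1 / (2 * density) := by
    rw [density_eq_zetaValue]
    field_simp
  set c : ℝ := 1 / (2 * density) with hc
  have hc_pos : 0 < c := by positivity
  -- the products are at least `1`
  have hprod_ge : ∀ (D : ℕ) (b : Fin D → ℕ), (∀ i, 0 < b i) →
      Real.exp (∑ i, (Nat.totient (b i) : ℝ) * Real.log (b i)) = ∏ i, ((b i : ℝ)) ^ (Nat.totient (b i)) := by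
    intro D b hb
    rw [Real.exp_sum]
    refine prod_congr rfl fun i _ => ?_
    rw [Real.exp_nat_mul, Real.exp_log (by exact_mod_cast hb i)]
  -- reduce to a lower bound for `∑ φ(bᵢ) log bᵢ`
  suffices h : ∃ D₀ : ℕ, ∀ D : ℕ, D₀ ≤ D → ∀ b : Fin D → ℕ, Function.Injective b → (∀ i, 0 < b i) →
      (c - ε) * (D : ℝ) ^ 2 * Real.log D ≤ ∑ i, (Nat.totient (b i) : ℝ) * Real.log (b i) by
    obtain ⟨D₀, hD₀⟩ := h
    refine ⟨D₀, fun D hD b hb hpos => ?_⟩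
    rw [hcA, ← hprod_ge D b hpos]
    exact Real.exp_le_exp.2 (hD₀ D hD b hb hpos)
  -- trivial when `ε ≥ c`
  by_cases hεc : c ≤ ε
  · refine ⟨1, fun D hD b hb hpos => ?_⟩
    have hD1 : (1 : ℝ) ≤ D := by exact_mod_cast hD
    refine le_trans (mul_nonpos_of_nonpos_of_nonneg
      (mul_nonpos_of_nonpos_of_nonneg (by linarith) (by positivity)) (Real.log_nonneg hD1)) ?_
    exact sum_nonneg fun i _ => mul_nonneg (Nat.cast_nonneg _)
      (Real.log_nonneg (by exact_mod_cast hpos i))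
  push Not at hεc
  -- parameters `δ₁ = ε A²/4`, `δ₂ = ε/4`, `K = (A/2 − δ₁)(1/A − δ₂)² ≥ c − ε/2`
  set δ₁ : ℝ := ε * density ^ 2 / 4 with hδ₁
  set δ₂ : ℝ := ε / 4 with hδ₂
  have hδ₁pos : 0 < δ₁ := by positivity
  have hδ₂pos : 0 < δ₂ := by positivity
  have hc' : c * (2 * density) = 1 := by rw [hc]; field_simp
  have hinvA : 1 / density = 2 * c := by rw [hc]; field_simp
  have hρpos : 0 < 1 / density - δ₂ := by rw [hinvA, hδ₂]; linarith
  have hA2 : 0 ≤ density / 2 - δ₁ := by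
    rw [hδ₁]
    -- `ε A²/4 ≤ A/2` iff `ε A ≤ 2`; `ε < c = 1/(2A)` gives `ε A < 1/2`
    have h1 : ε * density < 1 / 2 := by
      calc ε * density < c * density := by gcongr
        _ = 1 / 2 := by rw [hc]; field_simp
    have h2 : ε * density * density < 1 / 2 * density := mul_lt_mul_of_pos_right h1 hA
    nlinarith [h2]
  set K : ℝ := (density / 2 - δ₁) * (1 / density - δ₂) ^ 2 with hK
  have hKge : c - ε / 2 ≤ K := by
    have h1 : (1 / density) ^ 2 - 2 * δ₂ * (1 / density) ≤ (1 / density - δ₂) ^ 2 := by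
      have : (1 / density - δ₂) ^ 2 = (1 / density) ^ 2 - 2 * δ₂ * (1 / density) + δ₂ ^ 2 := by
        ring
      rw [this]
      nlinarith [sq_nonneg δ₂]
    have e : (density / 2 - δ₁) * ((1 / density) ^ 2 - 2 * δ₂ * (1 / density)) =
        c - δ₂ - δ₁ / density ^ 2 + 2 * δ₁ * δ₂ / density := by
      rw [hc]
      field_simp
      ring
    have e2 : δ₁ / density ^ 2 = ε / 4 := by
      rw [hδ₁]
      field_simp
    have e3 : 0 ≤ 2 * δ₁ * δ₂ / density := by positivity
    calc c - ε / 2 ≤ c - δ₂ - δ₁ / density ^ 2 + 2 * δ₁ * δ₂ / density := by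
          rw [e2, hδ₂]; linarith
      _ = (density / 2 - δ₁) * ((1 / density) ^ 2 - 2 * δ₂ * (1 / density)) := e.symm
      _ ≤ K := by rw [hK]; exact mul_le_mul_of_nonneg_left h1 hA2
  have hKpos : 0 < K := by linarith
  obtain ⟨M₀, hM₀⟩ := weightedSum_lower hδ₁pos
  obtain ⟨D₁, hD₁⟩ := threshold_lower hδ₂pos
  -- final threshold: `D ≥ D₁`, `Nat.find (exists_count_gt D) ≥ M₀`, `(1/A − δ₂) D ≥ 1`,
  -- `(ε/2) log D ≥ −K log(1/A − δ₂)`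
  set L : ℝ := Real.log (1 / density - δ₂) with hL
  obtain ⟨D₂, hD₂⟩ : ∃ D₂ : ℕ, ∀ D : ℕ, D₂ ≤ D →
      (1 ≤ (1 / density - δ₂) * D ∧ -(K * L) ≤ (ε / 2) * Real.log D) := by
    have h1 : ∀ᶠ D : ℕ in atTop, 1 ≤ (1 / density - δ₂) * D :=
      ((tendsto_natCast_atTop_atTop (R := ℝ)).const_mul_atTop hρpos).eventually_ge_atTop 1
    have h2 : ∀ᶠ D : ℕ in atTop, -(K * L) ≤ (ε / 2) * Real.log D :=
      (((Real.tendsto_log_atTop.comp (tendsto_natCast_atTop_atTop (R := ℝ))).const_mul_atTop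
        (by positivity : (0 : ℝ) < ε / 2))).eventually_ge_atTop _
    obtain ⟨D₂, h⟩ := eventually_atTop.1 (h1.and h2)
    exact ⟨D₂, fun D hD => by simpa only [Function.comp_apply] using h D hD⟩
  refine ⟨max (max D₁ D₂) (count (M₀ : ℕ)), fun D hD b hb hpos => ?_⟩
  have hDD₁ : D₁ ≤ D := le_trans (le_trans (le_max_left _ _) (le_max_left _ _)) hD
  have hDD₂ : D₂ ≤ D := le_trans (le_trans (le_max_right _ _) (le_max_left _ _)) hD
  have hDM₀ : count (M₀ : ℕ) ≤ D := le_trans (le_max_right _ _) hD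
  obtain ⟨hρD, hlogD⟩ := hD₂ D hDD₂
  obtain ⟨M, hMle, hMgt, hMmax⟩ := exists_threshold D
  have hMM₀ : M₀ ≤ M := hMmax M₀ hDM₀
  -- (1) `∑ φ(bᵢ) log bᵢ ≥ ∑ φ(bᵢ) log φ(bᵢ)`
  have h1 : ∑ i, (Nat.totient (b i) : ℝ) * Real.log (Nat.totient (b i)) ≤
      ∑ i, (Nat.totient (b i) : ℝ) * Real.log (b i) := by
    refine sum_le_sum fun i _ => mul_le_mul_of_nonneg_left ?_ (Nat.cast_nonneg _)
    have hφpos : (0 : ℝ) < Nat.totient (b i) := by exact_mod_cast Nat.totient_pos.2 (hpos i)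
    exact Real.log_le_log hφpos (by exact_mod_cast Nat.totient_le (b i))
  -- (2) rewrite as a sum over the image finset and apply the exchange inequality
  set S : Finset ℕ := Finset.univ.image b with hS
  have hScard : S.card = D := by
    rw [hS, card_image_of_injective _ hb, card_univ, Fintype.card_fin]
  have hSpos : ∀ k ∈ S, 0 < k := by
    intro k hk
    rw [hS, mem_image] at hk
    obtain ⟨i, -, rfl⟩ := hk
    exact hpos i
  have h2 : ∑ k ∈ S, (Nat.totient k : ℝ) * Real.log (Nat.totient k) =
      ∑ i, (Nat.totient (b i) : ℝ) * Real.log (Nat.totient (b i)) := by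
    rw [hS, sum_image fun i _ j _ h => hb h]
  have h3 : (∑ k ∈ (finite_count_set ((M : ℕ) : ℝ)).toFinset, (Nat.totient k : ℝ) * Real.log (Nat.totient k)) ≤ ∑ k ∈ S, (Nat.totient k : ℝ) * Real.log (Nat.totient k) :=
    weightedSum_le_sum hSpos (by rw [hScard]; exact hMle)
  -- (3) the asymptotic lower bound and the threshold bound
  have h4 := hM₀ M hMM₀
  have h5 := hD₁ D hDD₁ M hMgt
  have h6 : ((1 / density - δ₂) * D) ^ 2 * Real.log ((1 / density - δ₂) * D) ≤
      (M : ℝ) ^ 2 * Real.log M := sq_mul_log_mono hρD h5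
  -- (4) the final numerical inequality
  have hD0 : (0 : ℝ) < D := by
    have : (0 : ℝ) < (1 / density - δ₂) * D := lt_of_lt_of_le one_pos hρD
    exact pos_of_mul_pos_right this hρpos.le
  have hlogD0 : 0 ≤ Real.log D := Real.log_nonneg (by
    have : 1 ≤ D := Nat.one_le_iff_ne_zero.2 (by rintro rfl; simp at hD0)
    exact_mod_cast this)
  have h7 : (c - ε) * (D : ℝ) ^ 2 * Real.log D ≤
      (density / 2 - δ₁) * (((1 / density - δ₂) * D) ^ 2 * Real.log ((1 / density - δ₂) * D)) := by
    rw [Real.log_mul hρpos.ne' hD0.ne', ← hL]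
    -- RHS = K D² (L + log D)
    have hrhs : (density / 2 - δ₁) * (((1 / density - δ₂) * D) ^ 2 * (L + Real.log D)) =
        K * (D : ℝ) ^ 2 * L + K * (D : ℝ) ^ 2 * Real.log D := by rw [hK]; ring
    rw [hrhs]
    have hD2 : (0 : ℝ) ≤ (D : ℝ) ^ 2 := by positivity
    -- `(c − ε) log D ≤ K L + K log D` since `K ≥ c − ε/2` and `(ε/2) log D ≥ −K L`
    have e1 : (c - ε / 2) * Real.log D ≤ K * Real.log D := mul_le_mul_of_nonneg_right hKge hlogD0
    have : (c - ε) * Real.log D ≤ K * L + K * Real.log D := by linarith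
    calc (c - ε) * (D : ℝ) ^ 2 * Real.log D = (D : ℝ) ^ 2 * ((c - ε) * Real.log D) := by ring
      _ ≤ (D : ℝ) ^ 2 * (K * L + K * Real.log D) := mul_le_mul_of_nonneg_left this hD2
      _ = K * (D : ℝ) ^ 2 * L + K * (D : ℝ) ^ 2 * Real.log D := by ring
  calc (c - ε) * (D : ℝ) ^ 2 * Real.log D
      ≤ (density / 2 - δ₁) * (((1 / density - δ₂) * D) ^ 2 * Real.log ((1 / density - δ₂) * D)) := h7
    _ ≤ (density / 2 - δ₁) * ((M : ℝ) ^ 2 * Real.log M) := mul_le_mul_of_nonneg_left h6 hA2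
    _ = (density / 2 - δ₁) * (M : ℝ) ^ 2 * Real.log M := by ring
    _ ≤ (∑ k ∈ (finite_count_set ((M : ℕ) : ℝ)).toFinset, (Nat.totient k : ℝ) * Real.log (Nat.totient k)) := h4
    _ ≤ _ := h3
    _ = _ := h2
    _ ≤ _ := h1

end Literature.NumberTheory.Irrationality.LaiYu2020

end
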